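import Summits.Ventures.PercRepro.RankLevelSetLevelSevenT15Dev1
import Summits.Ventures.PercRepro.RankLevelSetLevelSevenT15Dev2
import Summits.Ventures.PercRepro.RankLevelSetLevelSevenT15Dev3
import Summits.Ventures.PercRepro.RankLevelSetLevelSevenT15Dev4
import Summits.Ventures.PercRepro.S4MidKeyFifteen
import Summits.Ventures.PercRepro.S4SevenWindow
import Summits.Ventures.PercRepro.RankLevelSetLevelSixRowsNineToFifteen

/-!
# PercRepro — THE 15 ROW OF LEVEL `7`: `c025_core_seven_fifteen (d ≥ 8) : RLS M 15 7` ON EVERY `e`-FREE CORE OF RANK `15`, AND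
**THEOREM C₇ AT RANK `15`** (p7 g24, S4 feeder; p8's assembly shape — NO window claim, p9 owns S4)

The core cells `(15, d)`: `8 ≤ d ≤ 74` by the coloop device with the lossy ladder (`c025_core_seven_fifteen_<d>`: `k` coloops reduce to the natural cell
`(15 − k, d)` of the row `15 − k` at the same corank, the rest retired — the generic device `c025_core_seven_of_cells_free` in RankLevelSetLevelSevenT15Dev1, RankLevelSetLevelSevenT15Dev2, RankLevelSetLevelSevenT15Dev3, RankLevelSetLevelSevenT15Dev4),
`d ≥ 75` by p1's middle key (`S4Mid.c025_core_seven_midkey_fifteen`, no coloop-freeness needed). Then the level-6 glue `rls_seven_at_of_core 15` on `c025_six_all`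
(level `6` at `p = 14`) gives level `7` at `p = 15`: **`c025_seven_at_fifteen : RLS M 15 7`** for every finite matroid.
Axioms: standard.
-/

open scoped Matroid

namespace PercRepro

namespace ThmN

variable {α : Type}

/-- **The core cell `(15, d)` at every corank `d ≥ 8`, every `e`-free core.** -/
theorem c025_core_seven_fifteen (M : Matroid α) [M.Finite] (d : ℕ) (hd8 : 8 ≤ d)
    (hR : M.eRank = (15 : ℕ∞)) (hn : M.E.ncard = 15 + d)
    (hfree : ∀ e ∈ M.E, ∃ A ⊆ M.E \ {e}, e ∉ M.closure A ∧ e ∉ M.closure ((M.E \ {e}) \ A)) :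
    RLS M 15 7 := by
  rcases Nat.lt_or_ge d 75 with hlt | hge
  · interval_cases d
    · exact c025_core_seven_fifteen_8 M hR hn hfree
    · exact c025_core_seven_fifteen_9 M hR hn hfree
    · exact c025_core_seven_fifteen_10 M hR hn hfree
    · exact c025_core_seven_fifteen_11 M hR hn hfree
    · exact c025_core_seven_fifteen_12 M hR hn hfree
    · exact c025_core_seven_fifteen_13 M hR hn hfree
    · exact c025_core_seven_fifteen_14 M hR hn hfree
    · exact c025_core_seven_fifteen_15 M hR hn hfree
    · exact c025_core_seven_fifteen_16 M hR hn hfree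
    · exact c025_core_seven_fifteen_17 M hR hn hfree
    · exact c025_core_seven_fifteen_18 M hR hn hfree
    · exact c025_core_seven_fifteen_19 M hR hn hfree
    · exact c025_core_seven_fifteen_20 M hR hn hfree
    · exact c025_core_seven_fifteen_21 M hR hn hfree
    · exact c025_core_seven_fifteen_22 M hR hn hfree
    · exact c025_core_seven_fifteen_23 M hR hn hfree
    · exact c025_core_seven_fifteen_24 M hR hn hfree
    · exact c025_core_seven_fifteen_25 M hR hn hfree
    · exact c025_core_seven_fifteen_26 M hR hn hfree
    · exact c025_core_seven_fifteen_27 M hR hn hfree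
    · exact c025_core_seven_fifteen_28 M hR hn hfree
    · exact c025_core_seven_fifteen_29 M hR hn hfree
    · exact c025_core_seven_fifteen_30 M hR hn hfree
    · exact c025_core_seven_fifteen_31 M hR hn hfree
    · exact c025_core_seven_fifteen_32 M hR hn hfree
    · exact c025_core_seven_fifteen_33 M hR hn hfree
    · exact c025_core_seven_fifteen_34 M hR hn hfree
    · exact c025_core_seven_fifteen_35 M hR hn hfree
    · exact c025_core_seven_fifteen_36 M hR hn hfree
    · exact c025_core_seven_fifteen_37 M hR hn hfree
    · exact c025_core_seven_fifteen_38 M hR hn hfree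
    · exact c025_core_seven_fifteen_39 M hR hn hfree
    · exact c025_core_seven_fifteen_40 M hR hn hfree
    · exact c025_core_seven_fifteen_41 M hR hn hfree
    · exact c025_core_seven_fifteen_42 M hR hn hfree
    · exact c025_core_seven_fifteen_43 M hR hn hfree
    · exact c025_core_seven_fifteen_44 M hR hn hfree
    · exact c025_core_seven_fifteen_45 M hR hn hfree
    · exact c025_core_seven_fifteen_46 M hR hn hfree
    · exact c025_core_seven_fifteen_47 M hR hn hfree
    · exact c025_core_seven_fifteen_48 M hR hn hfree
    · exact c025_core_seven_fifteen_49 M hR hn hfree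
    · exact c025_core_seven_fifteen_50 M hR hn hfree
    · exact c025_core_seven_fifteen_51 M hR hn hfree
    · exact c025_core_seven_fifteen_52 M hR hn hfree
    · exact c025_core_seven_fifteen_53 M hR hn hfree
    · exact c025_core_seven_fifteen_54 M hR hn hfree
    · exact c025_core_seven_fifteen_55 M hR hn hfree
    · exact c025_core_seven_fifteen_56 M hR hn hfree
    · exact c025_core_seven_fifteen_57 M hR hn hfree
    · exact c025_core_seven_fifteen_58 M hR hn hfree
    · exact c025_core_seven_fifteen_59 M hR hn hfree
    · exact c025_core_seven_fifteen_60 M hR hn hfree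
    · exact c025_core_seven_fifteen_61 M hR hn hfree
    · exact c025_core_seven_fifteen_62 M hR hn hfree
    · exact c025_core_seven_fifteen_63 M hR hn hfree
    · exact c025_core_seven_fifteen_64 M hR hn hfree
    · exact c025_core_seven_fifteen_65 M hR hn hfree
    · exact c025_core_seven_fifteen_66 M hR hn hfree
    · exact c025_core_seven_fifteen_67 M hR hn hfree
    · exact c025_core_seven_fifteen_68 M hR hn hfree
    · exact c025_core_seven_fifteen_69 M hR hn hfree
    · exact c025_core_seven_fifteen_70 M hR hn hfree
    · exact c025_core_seven_fifteen_71 M hR hn hfree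
    · exact c025_core_seven_fifteen_72 M hR hn hfree
    · exact c025_core_seven_fifteen_73 M hR hn hfree
    · exact c025_core_seven_fifteen_74 M hR hn hfree
  · exact S4Mid.c025_core_seven_midkey_fifteen M (by omega) hfree

/-- **THEOREM C₇ AT RANK `15`**: level `7` at `p = 15` for every finite matroid (on level `6` at `p = 14`, `c025_six_all`). -/
theorem c025_seven_at_fifteen (M : Matroid α) [M.Finite] : RLS M 15 7 :=
  rls_seven_at_of_core 15 (by norm_num) (fun M _ => c025_six_all M 14 (by norm_num))
    (fun M _ d hd hR hn hfree => c025_core_seven_fifteen M d hd hR hn hfree) M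

end ThmN

end PercRepro
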